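import Literature.NumberTheory.PAdicHodge.BdRPlusRamifiedLogEvalAdd
import Literature.NumberTheory.PAdicHodge.AinfRamifiedOmegaPeriodNonvanishing
import Literature.NumberTheory.PAdicHodge.AinfRamifiedDivisionLift
import Literature.NumberTheory.EllipticCurves.FormalGroupHasseInvariantProofs
import Literature.NumberTheory.EllipticCurves.FormalGroupLogHomAbelProofs
import HarnessLib

/-!
# The ramified `p`-adic `log_W` along a `[p]_W`-tower: `[p]`-functional equation at ARBITRARY depth and the ξ-adic bridge `∫_t ω`

Topic `Literature/NumberTheory/PAdicHodge`; namespace `Literature.NumberTheory.PAdicHodge.AinfRam` (and `AinfRamTop`). THEOREMS ONLY (no definition, no named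
fact, no instance, no `sorry`). Specialisation of the ramified evaluation layer `BdRPlusRamifiedLogEval{,Continuity,Add}` to THE FORMAL LOGARITHM of a
Weierstrass equation `W` over `𝒪_D = ℤ_p[ϖ]` (numerators `β_m = [X^{m−1}]ω_W ∈ 𝒪_D`, `ω_W = formalInvDiff`, so `β_m/m = [Xᵐ]log_W` in `F`):
* §1 `inv_mul_toBdR_coeffHom_formalInvDiff` — the numerator identity `(1/m)·ι_𝒪(β_m) = emb([Xᵐ]log_{W ⊗ F})`; `formalLog_subst_map_formalGroupLaw` —
  `log_W(F_W(X₀,X₁)) = log_W(X₀) + log_W(X₁)` over `F` for the base-changed law;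
* §2 ★ `value_nsmul` — for a point `P ∈ Ŵ(𝔫_𝒪)` (ANY depth) and a value `L` of `log_W` at `P` modulo `Fil^k`: `n·L` is a value at `n • P`; in particular
  ★ `value_mulP` — **`p·L` is a value at `[p]_W P`** (the functional equation `log_W([p]y) = p·log_W(y)` `p`-adically in `B_dR⁺/Fil^k`, at arbitrary depth);
* §3 ★★ `value_torsionLift_of_shift` — along a `[p]_W`-compatible sequence `t` of `Ŵ(𝔪_ℂ)`: if `L` is a value at Fontaine's element of the SHIFTED sequence
  `t(· + n)` then `pⁿ·L` is a value at Fontaine's element `[t]` (`[p]·[t⁺] = [t]`, `mulP_torsionLift_shift`);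
* §4 ★ `value_omegaPeriod` — **the ξ-adic bridge**: for a torsion sequence (`t₀ = 0`) K1's ramified ω-period `∫_t ω = log_W(ι_𝒪[t])` (ξ-adic evaluation at a
  `Fil¹`-point, `AinfRamifiedOmegaPeriod`) IS a value of the `p`-adic series at `[t]` modulo EVERY `Fil^k`.
Hence `∫_t ω = pⁿ·ev(log_W, [t⁽ⁿ⁾])` modulo every `Fil^k` — the W-side of the Hodge-line identity (crux K★ `stmt-BirchSwinnertonDyer-22226`, line `kato_lever`,
memo `Lines/kato-lever-K2-hne-direct-omega.md` §1, F2/F2b). Infrastructure only: BSD / K★ are not proved by any of this.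

## References
* J. H. Silverman, *The Arithmetic of Elliptic Curves* (2009), IV.2.3, IV.5.2, IV.5.5. [SilvermanAEC2009]
* J.-M. Fontaine, *Formes différentielles et modules de Tate…*, Invent. Math. 65 (1982), §5. [Fontaine1982FormesDifferentielles]
* J.-M. Fontaine, *Le corps des périodes p-adiques*, Astérisque 223 (1994), Exp. II §1.5.3–1.5.4. [FontaineAsterisque223III]
-/

noncomputable section

open MvPowerSeries (truncTotal)

namespace Literature.NumberTheory.PAdicHodge

namespace AinfRam

open ValuativeRel Field Ideal WittVector Finset
open Literature.NumberTheory.GaloisRepresentations Literature.NumberTheory.GaloisRepresentations.IsNonarchimedeanLocalField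
open Literature.NumberTheory.GaloisRepresentations.LubinTate
open GaloisContinuity Literature.RingTheory.FormalGroups

variable {F : Type} [Field F] [ValuativeRel F] [TopologicalSpace F] [IsNonarchimedeanLocalField F]
  [CharZero F] {p : ℕ} [Fact p.Prime] [Fact (¬ IsUnit (p : integerC F))]
  [IsAdicComplete (Ideal.span {(p : integerC F)}) (integerC F)]
  {hp : valuation F p < 1} (D : EisensteinRoot F p hp) (hθ : Function.Surjective (fontaineTheta (integerC F) p))
  (W : WeierstrassCurve (EisensteinRoot.CoeffDisc D))

/-! ## §1 The numerators of `log_W` and the functional equation over `F` -/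

/-- `qpToBdR = embBdRHom ∘ (ℚ_p → F)` (the canonical `LocalField.padicRingHom`). [cite: FontaineAsterisque223III, Exp. II §1.5.3] -/
theorem embBdRHom_padicRingHom' (q : ℚ_[p]) : embBdRHom hp hθ (LocalField.padicRingHom F p hp q) = qpToBdR q := by
  have h := embBdRHom_algebraMap (hp := hp) hθ ((PadicBase.toPadic hp).symm q)
  rw [PadicBase.algebraMap_eq, PadicBase.emb_apply, RingEquiv.apply_symm_apply] at h
  exact h

omit [Fact (¬ IsUnit (p : integerC F))] [IsAdicComplete (Ideal.span {(p : integerC F)}) (integerC F)] [ValuativeRel F] [TopologicalSpace F]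
  [IsNonarchimedeanLocalField F] [CharZero F] [Fact p.Prime] in
/-- `[X^{n+1}]log_V = (1/(n+1))·[Xⁿ]ω_V` for every `n` (over a `ℚ`-algebra; `ω_V(0) = 1 = [X]log_V`). [cite: SilvermanAEC2009, IV.5.5] -/
theorem coeff_succ_formalLog {A : Type*} [CommRing A] [Algebra ℚ A] (V : WeierstrassCurve A) (n : ℕ) :
    PowerSeries.coeff (n + 1) V.formalLog = algebraMap ℚ A (1 / ((n : ℚ) + 1)) * PowerSeries.coeff n V.formalOmega := by
  cases n with
  | zero =>
    rw [zero_add, WeierstrassCurve.coeff_one_formalLog, PowerSeries.coeff_zero_eq_constantCoeff, WeierstrassCurve.constantCoeff_formalOmega]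
    simp
  | succ n =>
    rw [WeierstrassCurve.formalLog, PowerSeries.coeff_mk]
    push_cast
    ring_nf

/-- ★ **The numerator identity for `log_W`**: with `β_m := [X^{m−1}]ω_W ∈ 𝒪_D` (`ω_W = formalInvDiff`), `(1/m)·ι_𝒪(β_m) = emb([Xᵐ]log_{W ⊗ F})` in `B_dR⁺` for
EVERY `m` (both sides vanish at `m = 0`). [cite: SilvermanAEC2009, IV.5.5] [cite: FontaineAsterisque223III, Exp. II §1.5.3] -/
theorem inv_mul_toBdR_coeffHom_formalInvDiff (m : ℕ) :
    qpToBdR ((m : ℚ_[p])⁻¹) * toBdR D hθ (coeffHom D ((EisensteinRoot.CoeffDisc.of D).symm (PowerSeries.coeff (m - 1) W.formalInvDiff))) =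
      embBdRHom hp hθ (PowerSeries.coeff m (W.map (EisensteinRoot.CoeffDisc.toF D)).formalLog) := by
  cases m with
  | zero =>
    rw [Nat.cast_zero, inv_zero, map_zero, zero_mul, PowerSeries.coeff_zero_eq_constantCoeff, WeierstrassCurve.constantCoeff_formalLog, map_zero]
  | succ n =>
    rw [Nat.add_sub_cancel, coeff_succ_formalLog, ← WeierstrassCurve.formalInvDiff_eq_formalOmega, ← WeierstrassCurve.map_formalInvDiff,
      PowerSeries.coeff_map, map_mul, toBdR_coeffHom]
    have h1 : embBdRHom hp hθ (algebraMap ℚ F (1 / ((n : ℚ) + 1))) = qpToBdR (((n + 1 : ℕ) : ℚ_[p])⁻¹) := by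
      rw [← embBdRHom_padicRingHom' (hp := hp) hθ, map_inv₀, map_natCast]
      congr 1
      rw [map_div₀, map_one, map_add, map_natCast, map_one, one_div, Nat.cast_succ]
    rw [h1]
    rfl

omit [Fact (¬ IsUnit (p : integerC F))] [IsAdicComplete (Ideal.span {(p : integerC F)}) (integerC F)] in
/-- **`log_W(F_W(X₀, X₁)) = log_W(X₀) + log_W(X₁)`** for the law of `W/𝒪_D` base-changed to `F` (tree `formalLog_subst_formalGroupLaw`, `map_formalGroupLaw`).
[cite: SilvermanAEC2009, IV.5.2] -/
theorem formalLog_subst_map_formalGroupLaw :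
    (W.map (EisensteinRoot.CoeffDisc.toF D)).formalLog.subst (MvPowerSeries.map (EisensteinRoot.CoeffDisc.toF D) W.formalGroupLaw) =
      (W.map (EisensteinRoot.CoeffDisc.toF D)).formalLog.subst (MvPowerSeries.X 0 : MvPowerSeries (Fin 2) F) +
        (W.map (EisensteinRoot.CoeffDisc.toF D)).formalLog.subst (MvPowerSeries.X 1 : MvPowerSeries (Fin 2) F) := by
  rw [WeierstrassCurve.map_formalGroupLaw]
  exact WeierstrassCurve.formalLog_subst_formalGroupLaw _

/-! ## §2 `n • P` and `[p]_W P`: the functional equation at arbitrary depth -/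

/-- `0` is a value of any series at the point `0`. [cite: Fontaine1982FormesDifferentielles, §5] -/
theorem value_zero {k : ℕ} (β : ℕ → D.Coeff) :
    ∀ j : ℕ, ∃ M₀ : ℕ, ∀ M : ℕ, M₀ ≤ M → ∃ (a : Ainf (p := p) F) (w : BDeRhamPlus (integerC F) p),
      (0 : BDeRhamPlus (integerC F) p) - (∑ m ∈ Finset.range M, qpToBdR (((m + 1 : ℕ) : ℚ_[p])⁻¹) *
        toBdR D hθ (coeffHom D (β (m + 1)) * (0 : AinfRam D) ^ (m + 1))) =
        ainfToBdR ((p : Ainf (p := p) F) ^ j * a) + xiBdR ^ k * w := by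
  intro j
  refine ⟨0, fun M _ => ⟨0, 0, ?_⟩⟩
  rw [Finset.sum_eq_zero fun m _ => by rw [zero_pow (Nat.succ_ne_zero m), mul_zero, map_zero, mul_zero]]
  simp

variable {W} in
/-- ★ **`n·L` is a value of `log_W` at `n • P`** for every point `P ∈ Ŵ(𝔫_𝒪)` (any depth) and every value `L` at `P` modulo `Fil^k`, for numerators `β` of
`log_{W ⊗ F}` (`(1/m)·ι_𝒪(β_m) = emb([Xᵐ]log_W)`, e.g. `β_m = [X^{m−1}]ω_W`, §1) — induction on `n` with the additivity `value_evalPt_of_add` along `F_W`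
(`(n+1) • P = n • P ⊕_W P`). [cite: SilvermanAEC2009, IV.2.3, IV.5.2] [cite: Fontaine1982FormesDifferentielles, §5] -/
theorem value_nsmul {k r : ℕ}
    (hr : ∀ x : AinfRam D, ∃ (a : Ainf (p := p) F) (w : BDeRhamPlus (integerC F) p),
      (p : BDeRhamPlus (integerC F) p) ^ r * toBdR D hθ x = ainfToBdR a + xiBdR ^ k * w)
    {β : ℕ → D.Coeff} (hβ : ∀ m : ℕ, qpToBdR ((m : ℚ_[p])⁻¹) * toBdR D hθ (coeffHom D (β m)) =
      embBdRHom hp hθ (PowerSeries.coeff m (W.map (EisensteinRoot.CoeffDisc.toF D)).formalLog))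
    (P : W.Pt (AinfRamTop.nilTheta D hθ)) {L : BDeRhamPlus (integerC F) p}
    (hL : ∀ j : ℕ, ∃ M₀ : ℕ, ∀ M : ℕ, M₀ ≤ M → ∃ (a : Ainf (p := p) F) (w : BDeRhamPlus (integerC F) p),
      L - (∑ m ∈ Finset.range M, qpToBdR (((m + 1 : ℕ) : ℚ_[p])⁻¹) *
        toBdR D hθ (coeffHom D (β (m + 1)) * (AinfRamTop.of D).symm (P.val : AinfRamTop D) ^ (m + 1))) =
        ainfToBdR ((p : Ainf (p := p) F) ^ j * a) + xiBdR ^ k * w) (n : ℕ) :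
    ∀ j : ℕ, ∃ M₀ : ℕ, ∀ M : ℕ, M₀ ≤ M → ∃ (a : Ainf (p := p) F) (w : BDeRhamPlus (integerC F) p),
      (n : BDeRhamPlus (integerC F) p) * L - (∑ m ∈ Finset.range M, qpToBdR (((m + 1 : ℕ) : ℚ_[p])⁻¹) *
        toBdR D hθ (coeffHom D (β (m + 1)) * (AinfRamTop.of D).symm ((n • P).val : AinfRamTop D) ^ (m + 1))) =
        ainfToBdR ((p : Ainf (p := p) F) ^ j * a) + xiBdR ^ k * w := by
  induction n with
  | zero =>
    rw [Nat.cast_zero, zero_mul, zero_nsmul, WeierstrassCurve.Pt.val_zero, ZeroMemClass.coe_zero, map_zero]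
    exact value_zero D hθ β
  | succ n ih =>
    rw [succ_nsmul, AinfRamTop.val_add_N, AinfRamTop.addW, Nat.cast_succ, add_mul, one_mul]
    exact value_evalPt_of_add D hθ hr ((W.map (EisensteinRoot.CoeffDisc.toF D)).formalLog) β hβ W.constantCoeff_formalGroupLaw
      (formalLog_subst_map_formalGroupLaw D W) (n • P).val P.val ih hL

variable {W} in
/-- ★ **The `[p]_W`-functional equation at arbitrary depth: `p·L` is a value of `log_W` at `[p]_W(y)`** for `y ∈ Ŵ(𝔫_𝒪)` and a value `L` at `y`.
[cite: SilvermanAEC2009, IV.2.3, IV.5.2] [cite: Fontaine1982FormesDifferentielles, §5] -/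
theorem value_mulP {k r : ℕ}
    (hr : ∀ x : AinfRam D, ∃ (a : Ainf (p := p) F) (w : BDeRhamPlus (integerC F) p),
      (p : BDeRhamPlus (integerC F) p) ^ r * toBdR D hθ x = ainfToBdR a + xiBdR ^ k * w)
    {β : ℕ → D.Coeff} (hβ : ∀ m : ℕ, qpToBdR ((m : ℚ_[p])⁻¹) * toBdR D hθ (coeffHom D (β m)) =
      embBdRHom hp hθ (PowerSeries.coeff m (W.map (EisensteinRoot.CoeffDisc.toF D)).formalLog))
    (y : (AinfRamTop.nilTheta D hθ).toIdeal) {L : BDeRhamPlus (integerC F) p}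
    (hL : ∀ j : ℕ, ∃ M₀ : ℕ, ∀ M : ℕ, M₀ ≤ M → ∃ (a : Ainf (p := p) F) (w : BDeRhamPlus (integerC F) p),
      L - (∑ m ∈ Finset.range M, qpToBdR (((m + 1 : ℕ) : ℚ_[p])⁻¹) *
        toBdR D hθ (coeffHom D (β (m + 1)) * (AinfRamTop.of D).symm (y : AinfRamTop D) ^ (m + 1))) =
        ainfToBdR ((p : Ainf (p := p) F) ^ j * a) + xiBdR ^ k * w) :
    ∀ j : ℕ, ∃ M₀ : ℕ, ∀ M : ℕ, M₀ ≤ M → ∃ (a : Ainf (p := p) F) (w : BDeRhamPlus (integerC F) p),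
      (p : BDeRhamPlus (integerC F) p) * L - (∑ m ∈ Finset.range M, qpToBdR (((m + 1 : ℕ) : ℚ_[p])⁻¹) *
        toBdR D hθ (coeffHom D (β (m + 1)) * (AinfRamTop.of D).symm ((AinfRamTop.mulP W y : (AinfRamTop.nilTheta D hθ).toIdeal) : AinfRamTop D) ^ (m + 1))) =
        ainfToBdR ((p : Ainf (p := p) F) ^ j * a) + xiBdR ^ k * w := by
  have h := value_nsmul D hθ hr hβ (⟨y⟩ : W.Pt (AinfRamTop.nilTheta D hθ)) hL p
  rwa [AinfRamTop.val_p_nsmul_N] at h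

/-! ## §3 Along a `[p]_W`-tower: `pⁿ·ev(log_W, [t⁽ⁿ⁾]) = ev(log_W, [t])` -/

variable {W} in
/-- The value predicate only depends on the point (transport along an equality of points). [folklore] -/
private theorem value_congr_point {k : ℕ} (β : ℕ → D.Coeff) {x x' : AinfRam D} (hx : x = x') {L : BDeRhamPlus (integerC F) p}
    (hL : ∀ j : ℕ, ∃ M₀ : ℕ, ∀ M : ℕ, M₀ ≤ M → ∃ (a : Ainf (p := p) F) (w : BDeRhamPlus (integerC F) p),
      L - (∑ m ∈ Finset.range M, qpToBdR (((m + 1 : ℕ) : ℚ_[p])⁻¹) * toBdR D hθ (coeffHom D (β (m + 1)) * x ^ (m + 1))) =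
        ainfToBdR ((p : Ainf (p := p) F) ^ j * a) + xiBdR ^ k * w) :
    ∀ j : ℕ, ∃ M₀ : ℕ, ∀ M : ℕ, M₀ ≤ M → ∃ (a : Ainf (p := p) F) (w : BDeRhamPlus (integerC F) p),
      L - (∑ m ∈ Finset.range M, qpToBdR (((m + 1 : ℕ) : ℚ_[p])⁻¹) * toBdR D hθ (coeffHom D (β (m + 1)) * x' ^ (m + 1))) =
        ainfToBdR ((p : Ainf (p := p) F) ^ j * a) + xiBdR ^ k * w := by
  subst hx; exact hL

variable {W} in
/-- ★★ **Descent along the tower.** For a `[p]_W`-compatible sequence `t` of `Ŵ(𝔪_ℂ)` and `n`: if `L` is a value of `log_W` modulo `Fil^k` at Fontaine's element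
`[t⁽ⁿ⁾]` of the SHIFTED sequence `m ↦ t(n + m)` (a shallow point: `θ_𝒪 = tₙ`), then `pⁿ·L` is a value at `[t]` (`[p]·[t⁺] = [t]`, `mulP_torsionLift_shift`).
[cite: Fontaine1982FormesDifferentielles, §5] [cite: FontaineAsterisque223III, Exp. II §1.5.4] -/
theorem value_torsionLift_of_shift {k r : ℕ}
    (hr : ∀ x : AinfRam D, ∃ (a : Ainf (p := p) F) (w : BDeRhamPlus (integerC F) p),
      (p : BDeRhamPlus (integerC F) p) ^ r * toBdR D hθ x = ainfToBdR a + xiBdR ^ k * w)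
    {β : ℕ → D.Coeff} (hβ : ∀ m : ℕ, qpToBdR ((m : ℚ_[p])⁻¹) * toBdR D hθ (coeffHom D (β m)) =
      embBdRHom hp hθ (PowerSeries.coeff m (W.map (EisensteinRoot.CoeffDisc.toF D)).formalLog)) (n : ℕ) :
    ∀ (t : ℕ → (maxNilIdealC F).toIdeal) (htp : ∀ m, AinfRamTop.mulPC W (t (m + 1)) = t m) {L : BDeRhamPlus (integerC F) p},
      (∀ j : ℕ, ∃ M₀ : ℕ, ∀ M : ℕ, M₀ ≤ M → ∃ (a : Ainf (p := p) F) (w : BDeRhamPlus (integerC F) p),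
        L - (∑ m ∈ Finset.range M, qpToBdR (((m + 1 : ℕ) : ℚ_[p])⁻¹) *
          toBdR D hθ (coeffHom D (β (m + 1)) *
            (AinfRamTop.of D).symm (AinfRamTop.torsionLift W hθ (fun m => t (n + m)) (fun m => htp (n + m))) ^ (m + 1))) =
          ainfToBdR ((p : Ainf (p := p) F) ^ j * a) + xiBdR ^ k * w) →
      ∀ j : ℕ, ∃ M₀ : ℕ, ∀ M : ℕ, M₀ ≤ M → ∃ (a : Ainf (p := p) F) (w : BDeRhamPlus (integerC F) p),
        (p : BDeRhamPlus (integerC F) p) ^ n * L - (∑ m ∈ Finset.range M, qpToBdR (((m + 1 : ℕ) : ℚ_[p])⁻¹) *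
          toBdR D hθ (coeffHom D (β (m + 1)) * (AinfRamTop.of D).symm (AinfRamTop.torsionLift W hθ t htp) ^ (m + 1))) =
          ainfToBdR ((p : Ainf (p := p) F) ^ j * a) + xiBdR ^ k * w := by
  induction n with
  | zero =>
    intro t htp L hL
    have hseq : (fun m => t (0 + m)) = t := funext fun m => by rw [Nat.zero_add]
    rw [pow_zero, one_mul]
    exact value_congr_point D hθ β (congrArg (AinfRamTop.of D).symm (AinfRamTop.torsionLift_congr_seq W hseq _ htp)) hL
  | succ n ih =>
    intro t htp L hL
    -- the shifted sequence `t⁺ = t(· + 1)`; `t(n + 1 + ·) = t⁺(n + ·)`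
    have htp' : ∀ m, AinfRamTop.mulPC W (t (m + 1 + 1)) = t (m + 1) := AinfRamTop.mulPC_shift W htp
    have hseq : (fun m => t (n + 1 + m)) = (fun m => t (n + m + 1)) := funext fun m => by rw [Nat.add_right_comm]
    have hL' := value_congr_point D hθ β (congrArg (AinfRamTop.of D).symm
      (AinfRamTop.torsionLift_congr_seq W hseq (fun m => htp (n + 1 + m)) (fun m => htp' (n + m)))) hL
    have h1 := ih (fun m => t (m + 1)) htp' hL'
    -- `[p]·[t⁺] = [t]`
    have h2 := value_mulP D hθ hr hβ ⟨AinfRamTop.torsionLift W hθ (fun m => t (m + 1)) htp',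
      AinfRamTop.flim_mem_nilTheta _ _⟩ h1
    rw [AinfRamTop.mulP_torsionLift_shift W htp, ← mul_assoc, ← pow_succ'] at h2
    exact h2

/-! ## §4 The ξ-adic bridge: K1's ramified ω-period `∫_t ω = log_W(ι_𝒪[t])` is a `p`-adic value at `[t]` -/

variable {W} in
/-- The `M`-th partial sum at `[t]`, read in `BdRPlusTop`, is the truncation `trunc_{M+1}(log_W)` evaluated at `ι_𝒪[t]`. [cite: Fontaine1982FormesDifferentielles, §5] -/
theorem of_partialSum_eq_aeval_trunc_logSeries {β : ℕ → D.Coeff} (hβ : ∀ m : ℕ, qpToBdR ((m : ℚ_[p])⁻¹) * toBdR D hθ (coeffHom D (β m)) =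
      embBdRHom hp hθ (PowerSeries.coeff m (W.map (EisensteinRoot.CoeffDisc.toF D)).formalLog)) (z : AinfRam D) (M : ℕ) :
    BdRPlusTop.of F p (∑ m ∈ Finset.range M, qpToBdR (((m + 1 : ℕ) : ℚ_[p])⁻¹) * toBdR D hθ (coeffHom D (β (m + 1)) * z ^ (m + 1))) =
      Polynomial.aeval (BdRPlusTop.of F p (toBdR D hθ z)) (PowerSeries.trunc (M + 1) (AinfRamTop.logSeries hθ W)) := by
  rw [partialSum_eq_sum_embBdRHom D hθ hβ, Polynomial.aeval_def, PowerSeries.eval₂_trunc_eq_sum_range, Finset.sum_range_succ', map_sum]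
  have h0 : (algebraMap (FieldCoeff hp hθ) (BdRPlusTop F p)) (PowerSeries.coeff 0 (AinfRamTop.logSeries hθ W)) *
      BdRPlusTop.of F p (toBdR D hθ z) ^ 0 = 0 := by
    rw [PowerSeries.coeff_zero_eq_constantCoeff, AinfRamTop.constantCoeff_logSeries, map_zero, zero_mul]
  rw [h0, add_zero]
  refine Finset.sum_congr rfl fun m _ => ?_
  rw [map_mul, map_pow, AinfRamTop.logSeries, PowerSeries.coeff_map, RingEquiv.toRingHom_eq_coe, RingHom.coe_coe, FieldCoeff.algebraMap_of]

variable {W} in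
/-- ★ **The ξ-adic bridge.** For a TORSION `[p]_W`-sequence `t` (`t₀ = 0`) K1's ramified ω-period `∫_t ω = log_W(ι_𝒪[t])` (`AinfRamTop.omegaPeriod`, the ξ-adic
evaluation at the `Fil¹`-point `ι_𝒪[t]`) IS a value of the `p`-adic series at `[t]` modulo EVERY `Fil^k`: `∫_t ω − S_M([t]) ∈ Fil^{M+1}`.
[cite: Fontaine1982FormesDifferentielles, §5] [cite: FontaineAsterisque223III, Exp. II §1.5.4] -/
theorem value_omegaPeriod {β : ℕ → D.Coeff} (hβ : ∀ m : ℕ, qpToBdR ((m : ℚ_[p])⁻¹) * toBdR D hθ (coeffHom D (β m)) =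
      embBdRHom hp hθ (PowerSeries.coeff m (W.map (EisensteinRoot.CoeffDisc.toF D)).formalLog))
    (k : ℕ) {t : ℕ → (maxNilIdealC F).toIdeal} (ht0 : (t 0 : CBall F) = 0) (htp : ∀ n, AinfRamTop.mulPC W (t (n + 1)) = t n) :
    ∀ j : ℕ, ∃ M₀ : ℕ, ∀ M : ℕ, M₀ ≤ M → ∃ (a : Ainf (p := p) F) (w : BDeRhamPlus (integerC F) p),
      (BdRPlusTop.of F p).symm (AinfRamTop.omegaPeriod W hθ t ht0 htp) - (∑ m ∈ Finset.range M, qpToBdR (((m + 1 : ℕ) : ℚ_[p])⁻¹) *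
        toBdR D hθ (coeffHom D (β (m + 1)) * (AinfRamTop.of D).symm (AinfRamTop.torsionLift W hθ t htp) ^ (m + 1))) =
        ainfToBdR ((p : Ainf (p := p) F) ^ j * a) + xiBdR ^ k * w := by
  set x : (BdRPlusTop.filOne F p).toIdeal := AinfRamTop.torsionLiftFil W hθ t ht0 htp with hx
  have hxt : IsTopologicallyNilpotent (x : BdRPlusTop F p) := (BdRPlusTop.filOne F p).isTopologicallyNilpotent _ x.2
  have hxcoe : (x : BdRPlusTop F p) = BdRPlusTop.of F p (toBdR D hθ ((AinfRamTop.of D).symm (AinfRamTop.torsionLift W hθ t htp))) :=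
    AinfRamTop.coe_torsionLiftFil W ht0 htp
  -- `∫_t ω − S_M ∈ Fil^{M+1}`
  have key : ∀ M : ℕ, AinfRamTop.omegaPeriod W hθ t ht0 htp -
      BdRPlusTop.of F p (∑ m ∈ Finset.range M, qpToBdR (((m + 1 : ℕ) : ℚ_[p])⁻¹) *
        toBdR D hθ (coeffHom D (β (m + 1)) * (AinfRamTop.of D).symm (AinfRamTop.torsionLift W hθ t htp) ^ (m + 1))) ∈
      (BdRPlusTop.filOne F p).toIdeal ^ (M + 1) := by
    intro M
    set q : Polynomial (FieldCoeff hp hθ) := PowerSeries.trunc (M + 1) (AinfRamTop.logSeries hθ W) with hq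
    have hval : AinfRamTop.omegaPeriod W hθ t ht0 htp -
        BdRPlusTop.of F p (∑ m ∈ Finset.range M, qpToBdR (((m + 1 : ℕ) : ℚ_[p])⁻¹) *
          toBdR D hθ (coeffHom D (β (m + 1)) * (AinfRamTop.of D).symm (AinfRamTop.torsionLift W hθ t htp) ^ (m + 1))) =
        PowerSeries.aeval hxt (AinfRamTop.logSeries hθ W - (q : PowerSeries (FieldCoeff hp hθ))) := by
      rw [map_sub, PowerSeries.aeval_coe, hq, of_partialSum_eq_aeval_trunc_logSeries D hθ hβ, ← hxcoe, AinfRamTop.omegaPeriod]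
      rfl
    rw [hval]
    have hclosed : IsClosed (((BdRPlusTop.filOne F p).toIdeal ^ (M + 1) : Ideal (BdRPlusTop F p)) : Set (BdRPlusTop F p)) :=
      BdRPlusTop.isClosed_of_pow_le le_rfl
    refine hclosed.mem_of_tendsto (PowerSeries.hasSum_aeval hxt _) (Filter.Eventually.of_forall fun T => ?_)
    refine Ideal.sum_mem _ fun d _ => ?_
    by_cases hd : d < M + 1
    · rw [map_sub, Polynomial.coeff_coe, hq, PowerSeries.coeff_trunc, if_pos hd, sub_self, zero_smul]
      exact Ideal.zero_mem _
    · rw [Algebra.smul_def]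
      exact Ideal.mul_mem_left _ _ (Ideal.pow_le_pow_right (by omega) (Ideal.pow_mem_pow x.2 d))
  intro j
  refine ⟨k, fun M hM => ?_⟩
  have h := Ideal.pow_le_pow_right (show k ≤ M + 1 by omega) (key M)
  rw [BdRPlusTop.mem_filOne_pow_iff, map_sub, RingEquiv.symm_apply_apply] at h
  obtain ⟨c, hc⟩ := Ideal.mem_span_singleton'.1 (Ideal.span_singleton_pow (xiBdR : BDeRhamPlus (integerC F) p) k ▸ h)
  exact ⟨0, c, by rw [mul_zero, map_zero, zero_add, mul_comm, hc]⟩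

end AinfRam

end Literature.NumberTheory.PAdicHodge

end
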